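import Literature.Probability.Percolation.TwoSetExchange
import Summits.CriticalPhenomena.PercolationContinuityZ3.Theorems.PercNearOneGluingNoHeavyLowerTailL1CertDict
import HarnessLib

/-!
# The port rows `R_bc`, `R_by` of the three-port transfer for Conjecture W follow from its terminal-pair pencil conditions `X_cy`, `X_bc`

Support file for crux `stmt-CriticalPhenomena-4575` (master-family programme; Conjecture W = row `Q44` ∀n), seat `prim-l12-p6` gen 28;
memos `run/shared/lean/prim/prim-l12/FROM-prim-l12-p6-g27-PORT-TRANSFER.md` §0 (3b) and `FROM-prim-l12-p6-g28-PORT-GLUING-LEAN.md`.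

In the three-port transfer of W (memo g27 §0; `…FourPointPortCells`, `…Q44PortGluing`) the conditions on the side `K` of `a` are `W(K)`, the
terminal-pair pencil conditions `X_cy, X_by, X_bc ≥ 0`, and the port rows `R_x, R_bc, R_by, R_cy ≥ 0`; `R_x`, `R_cy` are theorems (gen 27).  Here:
**`R_bc − X_cy` and `R_by − X_bc` are nonnegative on EVERY weighted graph** — each is a sum of instances of the two-set exchange
(van den Berg–Häggström–Kahn 2006, Thm. 2.1 at `q = 1`: given `{S ↮ T}`, two events increasing in `C_S` are positively correlated;
`Literature.Probability.Percolation.setTwoClusterExchange`) and cell monomials (exact degree-2 certificate, kit j215760; the separation-event dictionary entries `μ({c,y}↮b)`, `μ({a,b}↮y)` are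
`FourPointAtoms.real_xDcbDyb`, `real_xDayDby` of `…L1CertDict`):
* `ConjWPort.bhk_cy_b` — `S = {c,y}, T = {b}`: `(c₄+c₅+c₁₀)(c₁+c₁₀+c₁₁) ≤ c₁₀·(c₀+c₁+c₄+c₅+c₆+c₁₀+c₁₁)` (events `{a↔c} ∪ {a↔y}`, `{c↔y}`);
* `ConjWPort.bhk_ab_y` — `S = {a,b}, T = {y}`: `(c₅+c₁₃)(c₃+c₆+c₁₁+c₁₃) ≤ c₁₃·(c₀+c₁+c₃+c₅+c₆+c₁₁+c₁₃)` (events `{a↔c}`, `{a↔b} ∪ {b↔c}`);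
* `ConjWPort.bhk_abc_y` — `S = {a,b,c}, T = {y}`: `(c₃+c₁₃)(c₅+c₆+c₁₃) ≤ c₁₃·(c₀+c₃+c₅+c₆+c₁₃)` (events `{b↔c}`, `{a↔b} ∪ {a↔c}`);
* `ConjWPort.portRow_bc_of_xcy`: `R_bc = X_cy + bhk_cy_b + bhk_ab_y + (2c₀c₈ + 2c₁c₈ + c₃c₅ + c₄c₆ + c₄c₁₁ + 2c₆c₈ +
        2c₈c₁₁)`, so `X_cy ≥ 0 ⇒ R_bc ≥ 0`;
  `ConjWPort.portRow_by_of_xbc`: `R_by = X_bc + bhk_abc_y + (c₂c₅ + c₂c₆ + c₂c₁₃)`, so `X_bc ≥ 0 ⇒ R_by ≥ 0` (forms literally as in `…Q44PortGluing`).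
So the hypotheses of the gluing theorems reduce to the CORE `{W, X_cy, X_by, X_bc}` of the side of `a`.  Cells in the order of `FourPointAtoms.pat4`.
No definitions, no named facts, no sorries, standard axioms.
[cite: VandenbergHaggstromKahn2005, Thm. 2.1 (p. 9) at q = 1]
-/

noncomputable section

namespace Summit.CriticalPhenomena.PercolationContinuityZ3.Theorems

namespace ConjWPort

open MeasureTheory Set Literature.Probability.Percolation
open Literature.Probability.LatticeModels (prodBernoulli)
open FourPointAtoms
open Summit.CriticalPhenomena.PercolationContinuityZ3.Cruxes.AdditiveGluing.TieLine.ConnAtoms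
open scoped Classical

variable {n : ℕ} (w : Sym2 (Fin n) → unitInterval) (a b c y : Fin n)

/-! ### The separation events of the three exchanges as intersections of complements -/

/-- `{{c,y} ↮ b}` as an intersection of complements. [folklore] -/
theorem Dis_cy_b_eq :
    {ω : BondConfig (Fin n) | ∀ s ∈ ({c, y} : Set (Fin n)), ∀ t ∈ ({b} : Set (Fin n)), ¬ (openGraph ω).Reachable s t} =
      (openConn c b)ᶜ ∩ (openConn y b)ᶜ := by
  ext ω
  simp only [Set.mem_setOf_eq, Set.mem_insert_iff, Set.mem_singleton_iff, forall_eq_or_imp, forall_eq, Set.mem_inter_iff,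
    Set.mem_compl_iff, openConn]

/-- `{{a,b} ↮ y}` as an intersection of complements. [folklore] -/
theorem Dis_ab_y_eq :
    {ω : BondConfig (Fin n) | ∀ s ∈ ({a, b} : Set (Fin n)), ∀ t ∈ ({y} : Set (Fin n)), ¬ (openGraph ω).Reachable s t} =
      (openConn a y)ᶜ ∩ (openConn b y)ᶜ := by
  ext ω
  simp only [Set.mem_setOf_eq, Set.mem_insert_iff, Set.mem_singleton_iff, forall_eq_or_imp, forall_eq, Set.mem_inter_iff,
    Set.mem_compl_iff, openConn]

/-- `{{a,b,c} ↮ y}` as an intersection of complements. [folklore] -/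
theorem Dis_abc_y_eq :
    {ω : BondConfig (Fin n) | ∀ s ∈ ({a, b, c} : Set (Fin n)), ∀ t ∈ ({y} : Set (Fin n)), ¬ (openGraph ω).Reachable s t} =
      (openConn a y)ᶜ ∩ ((openConn b y)ᶜ ∩ (openConn c y)ᶜ) := by
  ext ω
  simp only [Set.mem_setOf_eq, Set.mem_insert_iff, Set.mem_singleton_iff, forall_eq_or_imp, forall_eq, Set.mem_inter_iff,
    Set.mem_compl_iff, openConn]

/-! ### Cell dictionary -/

/-- `μ({c,y}↮b ∩ ({c↔a} ∪ {y↔a})) = c₄+c₅+c₁₀`. [this work] -/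
theorem real_Dcyb_P1 : (prodBernoulli w).real ((openConn c b)ᶜ ∩ (openConn y b)ᶜ ∩ (openConn c a ∪ openConn y a)) = cell w a b c y 4 +
        cell w a b c y 5 + cell w a b c y 10 := by
  rw [measureReal_eq_cellSum w a b c y (show HasPattern (quad a b c y) ((openConn c b)ᶜ ∩ (openConn y b)ᶜ ∩ (openConn c a ∪ openConn y a)) _ from
    (((oc a b c y 2 1 rfl rfl).compl.inter (oc a b c y 3 1 rfl rfl).compl).inter ((oc a b c y 2 0 rfl rfl).union (oc a b c y 3 0 rfl rfl))))]
  simp (config := {decide := true}) only [ite_true, ite_false]; ring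

/-- `μ({c,y}↮b ∩ {c↔y}) = c₁+c₁₀+c₁₁`. [this work] -/
theorem real_Dcyb_P2 : (prodBernoulli w).real ((openConn c b)ᶜ ∩ (openConn y b)ᶜ ∩ openConn c y) = cell w a b c y 1 + cell w a b c y 10 +
        cell w a b c y 11 := by
  rw [measureReal_eq_cellSum w a b c y (show HasPattern (quad a b c y) ((openConn c b)ᶜ ∩ (openConn y b)ᶜ ∩ openConn c y) _ from
    (((oc a b c y 2 1 rfl rfl).compl.inter (oc a b c y 3 1 rfl rfl).compl).inter (oc a b c y 2 3 rfl rfl)))]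
  simp (config := {decide := true}) only [ite_true, ite_false]; ring

/-- `μ({c,y}↮b ∩ (({c↔a} ∪ {y↔a}) ∩ {c↔y})) = c₁₀`. [this work] -/
theorem real_Dcyb_P12 : (prodBernoulli w).real ((openConn c b)ᶜ ∩ (openConn y b)ᶜ ∩ ((openConn c a ∪ openConn y a) ∩ openConn c y)) = cell w a b c y 10 := by
  rw [measureReal_eq_cellSum w a b c y (show HasPattern (quad a b c y) ((openConn c b)ᶜ ∩ (openConn y b)ᶜ ∩ ((openConn c a ∪ openConn y a) ∩ openConn c y)) _ from
    (((oc a b c y 2 1 rfl rfl).compl.inter (oc a b c y 3 1 rfl rfl).compl).inter (((oc a b c y 2 0 rfl rfl).union (oc a b c y 3 0 rfl rfl)).inter (oc a b c y 2 3 rfl rfl))))]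
  simp (config := {decide := true}) only [ite_true, ite_false]; ring

/-- `μ({a,b}↮y ∩ {a↔c}) = c₅+c₁₃`. [this work] -/
theorem real_Daby_P1 : (prodBernoulli w).real ((openConn a y)ᶜ ∩ (openConn b y)ᶜ ∩ openConn a c) = cell w a b c y 5 + cell w a b c y 13 := by
  rw [measureReal_eq_cellSum w a b c y (show HasPattern (quad a b c y) ((openConn a y)ᶜ ∩ (openConn b y)ᶜ ∩ openConn a c) _ from
    (((oc a b c y 0 3 rfl rfl).compl.inter (oc a b c y 1 3 rfl rfl).compl).inter (oc a b c y 0 2 rfl rfl)))]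
  simp (config := {decide := true}) only [ite_true, ite_false]; ring

/-- `μ({a,b}↮y ∩ ({a↔b} ∪ {b↔c})) = c₃+c₆+c₁₁+c₁₃`. [this work] -/
theorem real_Daby_P2 : (prodBernoulli w).real ((openConn a y)ᶜ ∩ (openConn b y)ᶜ ∩ (openConn a b ∪ openConn b c)) = cell w a b c y 3 +
        cell w a b c y 6 + cell w a b c y 11 + cell w a b c y 13 := by
  rw [measureReal_eq_cellSum w a b c y (show HasPattern (quad a b c y) ((openConn a y)ᶜ ∩ (openConn b y)ᶜ ∩ (openConn a b ∪ openConn b c)) _ from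
    (((oc a b c y 0 3 rfl rfl).compl.inter (oc a b c y 1 3 rfl rfl).compl).inter ((oc a b c y 0 1 rfl rfl).union (oc a b c y 1 2 rfl rfl))))]
  simp (config := {decide := true}) only [ite_true, ite_false]; ring

/-- `μ({a,b}↮y ∩ ({a↔c} ∩ ({a↔b} ∪ {b↔c}))) = c₁₃`. [this work] -/
theorem real_Daby_P12 : (prodBernoulli w).real ((openConn a y)ᶜ ∩ (openConn b y)ᶜ ∩ (openConn a c ∩ (openConn a b ∪ openConn b c))) = cell w a b c y 13 := by
  rw [measureReal_eq_cellSum w a b c y (show HasPattern (quad a b c y) ((openConn a y)ᶜ ∩ (openConn b y)ᶜ ∩ (openConn a c ∩ (openConn a b ∪ openConn b c))) _ from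
    (((oc a b c y 0 3 rfl rfl).compl.inter (oc a b c y 1 3 rfl rfl).compl).inter ((oc a b c y 0 2 rfl rfl).inter ((oc a b c y 0 1 rfl rfl).union (oc a b c y 1 2 rfl rfl)))))]
  simp (config := {decide := true}) only [ite_true, ite_false]; ring

/-- `μ({a,b,c}↮y) = c₀+c₃+c₅+c₆+c₁₃`. [this work] -/
theorem real_Dabcy : (prodBernoulli w).real ((openConn a y)ᶜ ∩ ((openConn b y)ᶜ ∩ (openConn c y)ᶜ)) = cell w a b c y 0 + cell w a b c y 3 +
        cell w a b c y 5 + cell w a b c y 6 + cell w a b c y 13 := by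
  rw [measureReal_eq_cellSum w a b c y (show HasPattern (quad a b c y) ((openConn a y)ᶜ ∩ ((openConn b y)ᶜ ∩ (openConn c y)ᶜ)) _ from
    ((oc a b c y 0 3 rfl rfl).compl.inter ((oc a b c y 1 3 rfl rfl).compl.inter (oc a b c y 2 3 rfl rfl).compl)))]
  simp (config := {decide := true}) only [ite_true, ite_false]; ring

/-- `μ({a,b,c}↮y ∩ {b↔c}) = c₃+c₁₃`. [this work] -/
theorem real_Dabcy_P1 : (prodBernoulli w).real ((openConn a y)ᶜ ∩ ((openConn b y)ᶜ ∩ (openConn c y)ᶜ) ∩ openConn b c) = cell w a b c y 3 +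
        cell w a b c y 13 := by
  rw [measureReal_eq_cellSum w a b c y (show HasPattern (quad a b c y) ((openConn a y)ᶜ ∩ ((openConn b y)ᶜ ∩ (openConn c y)ᶜ) ∩ openConn b c) _ from
    (((oc a b c y 0 3 rfl rfl).compl.inter ((oc a b c y 1 3 rfl rfl).compl.inter (oc a b c y 2 3 rfl rfl).compl)).inter (oc a b c y 1 2 rfl rfl)))]
  simp (config := {decide := true}) only [ite_true, ite_false]; ring

/-- `μ({a,b,c}↮y ∩ ({a↔b} ∪ {a↔c})) = c₅+c₆+c₁₃`. [this work] -/
theorem real_Dabcy_P2 : (prodBernoulli w).real ((openConn a y)ᶜ ∩ ((openConn b y)ᶜ ∩ (openConn c y)ᶜ) ∩ (openConn a b ∪ openConn a c)) = cell w a b c y 5 +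
        cell w a b c y 6 + cell w a b c y 13 := by
  rw [measureReal_eq_cellSum w a b c y (show HasPattern (quad a b c y) ((openConn a y)ᶜ ∩ ((openConn b y)ᶜ ∩ (openConn c y)ᶜ) ∩ (openConn a b ∪ openConn a c)) _ from
    (((oc a b c y 0 3 rfl rfl).compl.inter ((oc a b c y 1 3 rfl rfl).compl.inter (oc a b c y 2 3 rfl rfl).compl)).inter ((oc a b c y 0 1 rfl rfl).union (oc a b c y 0 2 rfl rfl))))]
  simp (config := {decide := true}) only [ite_true, ite_false]; ring

/-- `μ({a,b,c}↮y ∩ ({b↔c} ∩ ({a↔b} ∪ {a↔c}))) = c₁₃`. [this work] -/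
theorem real_Dabcy_P12 : (prodBernoulli w).real ((openConn a y)ᶜ ∩ ((openConn b y)ᶜ ∩ (openConn c y)ᶜ) ∩ (openConn b c ∩ (openConn a b ∪ openConn a c))) = cell w a b c y 13 := by
  rw [measureReal_eq_cellSum w a b c y (show HasPattern (quad a b c y) ((openConn a y)ᶜ ∩ ((openConn b y)ᶜ ∩ (openConn c y)ᶜ) ∩ (openConn b c ∩ (openConn a b ∪ openConn a c))) _ from
    (((oc a b c y 0 3 rfl rfl).compl.inter ((oc a b c y 1 3 rfl rfl).compl.inter (oc a b c y 2 3 rfl rfl).compl)).inter ((oc a b c y 1 2 rfl rfl).inter ((oc a b c y 0 1 rfl rfl).union (oc a b c y 0 2 rfl rfl)))))]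
  simp (config := {decide := true}) only [ite_true, ite_false]; ring

/-! ### Three two-set exchange rows -/

/-- **Two-set exchange given `{c,y} ↮ b`**: the events `{c↔a} ∪ {y↔a}` and `{c↔y}` (both increasing in `C_{{c,y}}`) are positively correlated on
`{c,y} ↮ b`: `(c₄+c₅+c₁₀)(c₁+c₁₀+c₁₁) ≤ c₁₀·(c₀+c₁+c₄+c₅+c₆+c₁₀+c₁₁)`. [cite: VandenbergHaggstromKahn2005, Thm. 2.1 (p. 9) at q = 1] -/
theorem bhk_cy_b :
    (cell w a b c y 4 + cell w a b c y 5 + cell w a b c y 10) * (cell w a b c y 1 + cell w a b c y 10 + cell w a b c y 11) ≤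
      cell w a b c y 10 * (cell w a b c y 0 + cell w a b c y 1 + cell w a b c y 4 + cell w a b c y 5 + cell w a b c y 6 + cell w a b c y 10 +
        cell w a b c y 11) := by
  have hc : c ∈ ({c, y} : Set (Fin n)) := by simp
  have hy : y ∈ ({c, y} : Set (Fin n)) := by simp
  have key := setTwoClusterExchange w ({c, y} : Set (Fin n)) ({b} : Set (Fin n))
    (A₁ := (openConn c a ∪ openConn y a : Set (BondConfig (Fin n)))) (A₂ := (openConn c y : Set (BondConfig (Fin n))))
    (B₁ := (Set.univ : Set (BondConfig (Fin n)))) (B₂ := (Set.univ : Set (BondConfig (Fin n))))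
    (fun ω ω' hs ht h => h.elim (fun h1 => Or.inl (TwoSetExchange.typePlus_openConn_of_mem _ _ hc a hs ht h1))
      (fun h2 => Or.inr (TwoSetExchange.typePlus_openConn_of_mem _ _ hy a hs ht h2)))
    (TwoSetExchange.typePlus_openConn_of_mem _ _ hc y) (fun _ _ _ _ _ => Set.mem_univ _) (fun _ _ _ _ _ => Set.mem_univ _)
  simp only [Set.inter_univ, Dis_cy_b_eq] at key
  rw [real_Dcyb_P1, real_Dcyb_P2, real_Dcyb_P12, real_xDcbDyb] at key
  exact key

/-- **Two-set exchange given `{a,b} ↮ y`**: the events `{a↔c}` and `{a↔b} ∪ {b↔c}` (increasing in `C_{{a,b}}`) are positively correlated on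
`{a,b} ↮ y`: `(c₅+c₁₃)(c₃+c₆+c₁₁+c₁₃) ≤ c₁₃·(c₀+c₁+c₃+c₅+c₆+c₁₁+c₁₃)`. [cite: VandenbergHaggstromKahn2005, Thm. 2.1 (p. 9) at q = 1] -/
theorem bhk_ab_y :
    (cell w a b c y 5 + cell w a b c y 13) * (cell w a b c y 3 + cell w a b c y 6 + cell w a b c y 11 + cell w a b c y 13) ≤
      cell w a b c y 13 * (cell w a b c y 0 + cell w a b c y 1 + cell w a b c y 3 + cell w a b c y 5 + cell w a b c y 6 + cell w a b c y 11 +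
        cell w a b c y 13) := by
  have ha : a ∈ ({a, b} : Set (Fin n)) := by simp
  have hb : b ∈ ({a, b} : Set (Fin n)) := by simp
  have key := setTwoClusterExchange w ({a, b} : Set (Fin n)) ({y} : Set (Fin n))
    (A₁ := (openConn a c : Set (BondConfig (Fin n)))) (A₂ := (openConn a b ∪ openConn b c : Set (BondConfig (Fin n))))
    (B₁ := (Set.univ : Set (BondConfig (Fin n)))) (B₂ := (Set.univ : Set (BondConfig (Fin n))))
    (TwoSetExchange.typePlus_openConn_of_mem _ _ ha c)
    (fun ω ω' hs ht h => h.elim (fun h1 => Or.inl (TwoSetExchange.typePlus_openConn_of_mem _ _ ha b hs ht h1))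
      (fun h2 => Or.inr (TwoSetExchange.typePlus_openConn_of_mem _ _ hb c hs ht h2)))
    (fun _ _ _ _ _ => Set.mem_univ _) (fun _ _ _ _ _ => Set.mem_univ _)
  simp only [Set.inter_univ, Dis_ab_y_eq] at key
  rw [real_Daby_P1, real_Daby_P2, real_Daby_P12, real_xDayDby] at key
  exact key

/-- **Two-set exchange given `{a,b,c} ↮ y`**: the events `{b↔c}` and `{a↔b} ∪ {a↔c}` (increasing in `C_{{a,b,c}}`) are positively correlated on
`{a,b,c} ↮ y`: `(c₃+c₁₃)(c₅+c₆+c₁₃) ≤ c₁₃·(c₀+c₃+c₅+c₆+c₁₃)` (a two-term strengthening of the type-B row `c₃c₆ ≤ c₀c₁₃`).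
[cite: VandenbergHaggstromKahn2005, Thm. 2.1 (p. 9) at q = 1] -/
theorem bhk_abc_y :
    (cell w a b c y 3 + cell w a b c y 13) * (cell w a b c y 5 + cell w a b c y 6 + cell w a b c y 13) ≤
      cell w a b c y 13 * (cell w a b c y 0 + cell w a b c y 3 + cell w a b c y 5 + cell w a b c y 6 + cell w a b c y 13) := by
  have ha : a ∈ ({a, b, c} : Set (Fin n)) := by simp
  have hb : b ∈ ({a, b, c} : Set (Fin n)) := by simp
  have key := setTwoClusterExchange w ({a, b, c} : Set (Fin n)) ({y} : Set (Fin n))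
    (A₁ := (openConn b c : Set (BondConfig (Fin n)))) (A₂ := (openConn a b ∪ openConn a c : Set (BondConfig (Fin n))))
    (B₁ := (Set.univ : Set (BondConfig (Fin n)))) (B₂ := (Set.univ : Set (BondConfig (Fin n))))
    (TwoSetExchange.typePlus_openConn_of_mem _ _ hb c)
    (fun ω ω' hs ht h => h.elim (fun h1 => Or.inl (TwoSetExchange.typePlus_openConn_of_mem _ _ ha b hs ht h1))
      (fun h2 => Or.inr (TwoSetExchange.typePlus_openConn_of_mem _ _ ha c hs ht h2)))
    (fun _ _ _ _ _ => Set.mem_univ _) (fun _ _ _ _ _ => Set.mem_univ _)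
  simp only [Set.inter_univ, Dis_abc_y_eq] at key
  rw [real_Dabcy_P1, real_Dabcy_P2, real_Dabcy_P12, real_Dabcy] at key
  exact key

/-! ### The port rows from the pencil conditions -/

/-- **`R_bc ≥ X_cy` on every weighted graph**: if the terminal-pair pencil form `X_cy` (the leading coefficient of W along a new pair `cy`) is
nonnegative, so is the port row `R_bc` of the three-port transfer — `R_bc − X_cy = bhk_cy_b + bhk_ab_y + 7 cell monomials` (exact certificate,
kit j215760).  Forms literally as in the hypotheses `hXcy`, `hRbc` of `ConjWPort.q44_cells_of_portSplit`. [this work] -/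
theorem portRow_bc_of_xcy
    (hXcy : 0 ≤ 2 * cell w a b c y 0 * cell w a b c y 9 + 2 * cell w a b c y 0 * cell w a b c y 11 + cell w a b c y 0 * cell w a b c y 12 +
        cell w a b c y 0 * cell w a b c y 13 + 2 * cell w a b c y 0 * cell w a b c y 14 - (2 * cell w a b c y 1 * cell w a b c y 6 +
        2 * cell w a b c y 1 * cell w a b c y 8 + cell w a b c y 1 * cell w a b c y 12 + cell w a b c y 1 * cell w a b c y 13 +
        cell w a b c y 2 * cell w a b c y 4 + 2 * cell w a b c y 2 * cell w a b c y 5 + cell w a b c y 2 * cell w a b c y 6 +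
        cell w a b c y 2 * cell w a b c y 10 + cell w a b c y 3 * cell w a b c y 5 + cell w a b c y 3 * cell w a b c y 6 +
        cell w a b c y 4 * cell w a b c y 6 + cell w a b c y 5 * cell w a b c y 6 + cell w a b c y 5 * cell w a b c y 7 +
        cell w a b c y 6 * cell w a b c y 7 + 2 * cell w a b c y 6 * cell w a b c y 8 + 2 * cell w a b c y 6 * cell w a b c y 9 +
        cell w a b c y 6 * cell w a b c y 10 + 2 * cell w a b c y 8 * cell w a b c y 11 + 2 * cell w a b c y 9 * cell w a b c y 11)) :
    0 ≤ 2 * cell w a b c y 0 * cell w a b c y 8 + 2 * cell w a b c y 0 * cell w a b c y 9 + cell w a b c y 0 * cell w a b c y 10 +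
        2 * cell w a b c y 0 * cell w a b c y 11 + cell w a b c y 0 * cell w a b c y 12 + 2 * cell w a b c y 0 * cell w a b c y 13 +
        2 * cell w a b c y 0 * cell w a b c y 14 - (cell w a b c y 1 * cell w a b c y 4 + cell w a b c y 1 * cell w a b c y 5 +
        2 * cell w a b c y 1 * cell w a b c y 6 + cell w a b c y 1 * cell w a b c y 12 + cell w a b c y 2 * cell w a b c y 4 +
        2 * cell w a b c y 2 * cell w a b c y 5 + cell w a b c y 2 * cell w a b c y 6 + cell w a b c y 2 * cell w a b c y 10 +
        cell w a b c y 3 * cell w a b c y 5 + cell w a b c y 3 * cell w a b c y 6 + 2 * cell w a b c y 5 * cell w a b c y 6 +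
        cell w a b c y 5 * cell w a b c y 7 + 2 * cell w a b c y 5 * cell w a b c y 11 + cell w a b c y 6 * cell w a b c y 7 +
        2 * cell w a b c y 6 * cell w a b c y 9 + 2 * cell w a b c y 9 * cell w a b c y 11) := by
  have r1 := bhk_cy_b w a b c y
  have r2 := bhk_ab_y w a b c y
  have h0 := cell_nonneg w a b c y 0
  have h1 := cell_nonneg w a b c y 1
  have h2 := cell_nonneg w a b c y 2
  have h3 := cell_nonneg w a b c y 3
  have h4 := cell_nonneg w a b c y 4
  have h5 := cell_nonneg w a b c y 5
  have h6 := cell_nonneg w a b c y 6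
  have h7 := cell_nonneg w a b c y 7
  have h8 := cell_nonneg w a b c y 8
  have h9 := cell_nonneg w a b c y 9
  have h10 := cell_nonneg w a b c y 10
  have h11 := cell_nonneg w a b c y 11
  have h12 := cell_nonneg w a b c y 12
  have h13 := cell_nonneg w a b c y 13
  have h14 := cell_nonneg w a b c y 14
  nlinarith [r1, r2, hXcy, mul_nonneg h0 h8, mul_nonneg h1 h8, mul_nonneg h3 h5, mul_nonneg h4 h6, mul_nonneg h4 h11, mul_nonneg h6 h8,
    mul_nonneg h8 h11]

/-- **`R_by ≥ X_bc` on every weighted graph**: `R_by − X_bc = bhk_abc_y + c₂c₅ + c₂c₆ + c₂c₁₃`.  Forms literally as in the hypotheses `hXbc`,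
`hRby` of `ConjWPort.q44_cells_of_portSplit`. [this work] -/
theorem portRow_by_of_xbc
    (hXbc : 0 ≤ 2 * cell w a b c y 0 * cell w a b c y 9 + 2 * cell w a b c y 0 * cell w a b c y 10 + 2 * cell w a b c y 0 * cell w a b c y 11 +
        2 * cell w a b c y 0 * cell w a b c y 12 + 2 * cell w a b c y 0 * cell w a b c y 14 - (2 * cell w a b c y 1 * cell w a b c y 4 +
        2 * cell w a b c y 1 * cell w a b c y 5 + 2 * cell w a b c y 1 * cell w a b c y 6 + 2 * cell w a b c y 1 * cell w a b c y 8 +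
        cell w a b c y 1 * cell w a b c y 13 + 2 * cell w a b c y 2 * cell w a b c y 5 + 2 * cell w a b c y 2 * cell w a b c y 6 +
        cell w a b c y 2 * cell w a b c y 13 + 2 * cell w a b c y 4 * cell w a b c y 6 + 2 * cell w a b c y 4 * cell w a b c y 11 +
        cell w a b c y 5 * cell w a b c y 7 + cell w a b c y 6 * cell w a b c y 7 + 2 * cell w a b c y 6 * cell w a b c y 8 +
        2 * cell w a b c y 8 * cell w a b c y 11)) :
    0 ≤ 2 * cell w a b c y 0 * cell w a b c y 9 + 2 * cell w a b c y 0 * cell w a b c y 10 + 2 * cell w a b c y 0 * cell w a b c y 11 +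
        2 * cell w a b c y 0 * cell w a b c y 12 + cell w a b c y 0 * cell w a b c y 13 +
        2 * cell w a b c y 0 * cell w a b c y 14 - (2 * cell w a b c y 1 * cell w a b c y 4 + 2 * cell w a b c y 1 * cell w a b c y 5 +
        2 * cell w a b c y 1 * cell w a b c y 6 + 2 * cell w a b c y 1 * cell w a b c y 8 + cell w a b c y 1 * cell w a b c y 13 +
        cell w a b c y 2 * cell w a b c y 5 + cell w a b c y 2 * cell w a b c y 6 + cell w a b c y 3 * cell w a b c y 5 +
        cell w a b c y 3 * cell w a b c y 6 + 2 * cell w a b c y 4 * cell w a b c y 6 + 2 * cell w a b c y 4 * cell w a b c y 11 +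
        cell w a b c y 5 * cell w a b c y 7 + cell w a b c y 6 * cell w a b c y 7 + 2 * cell w a b c y 6 * cell w a b c y 8 +
        2 * cell w a b c y 8 * cell w a b c y 11) := by
  have r3 := bhk_abc_y w a b c y
  have h0 := cell_nonneg w a b c y 0
  have h1 := cell_nonneg w a b c y 1
  have h2 := cell_nonneg w a b c y 2
  have h3 := cell_nonneg w a b c y 3
  have h4 := cell_nonneg w a b c y 4
  have h5 := cell_nonneg w a b c y 5
  have h6 := cell_nonneg w a b c y 6
  have h7 := cell_nonneg w a b c y 7
  have h8 := cell_nonneg w a b c y 8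
  have h9 := cell_nonneg w a b c y 9
  have h10 := cell_nonneg w a b c y 10
  have h11 := cell_nonneg w a b c y 11
  have h12 := cell_nonneg w a b c y 12
  have h13 := cell_nonneg w a b c y 13
  have h14 := cell_nonneg w a b c y 14
  nlinarith [r3, hXbc, mul_nonneg h2 h5, mul_nonneg h2 h6, mul_nonneg h2 h13]

end ConjWPort

end Summit.CriticalPhenomena.PercolationContinuityZ3.Theorems
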